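import Literature.Analysis.FluidPDE.AxisymmetricNoSwirlWeightedEnstrophy
import Literature.Analysis.FluidPDE.LadyzhenskayaWeightedEstimate
import Literature.Analysis.FluidPDE.KNSSThm52Integrand
import HarnessLib

/-!
# Proof of `axisymmetricNoSwirl_weightedEnstrophy_le`: Ladyzhenskaya's bound `∫ |ω(t)|² r⁻² ≤ ‖ω₀‖²_{Ḣ¹}`

Analysis/FluidPDE proof file (all results proved, no definitions): the discharge
`axisymmetricNoSwirl_weightedEnstrophy_le_holds` of the named fact
`Literature.Analysis.FluidPDE.axisymmetricNoSwirl_weightedEnstrophy_le`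
(`AxisymmetricNoSwirlWeightedEnstrophy.lean`; Lemarié-Rieusset 2016, proof of Thm. 10.4,
(10.27) with `f = 0`, p. 288: for a regular Navier–Stokes solution which is axisymmetric without
swirl, `∫ |ω(t)|² r⁻² dx ≤ ‖ω₀‖²_{Ḣ¹}`), in Tao's smooth class `IsTaoSolutionOn`
(`TaoClassGlue.lean`).

The analytic heart is the tree's `ladyzhenskaya_weighted_estimate`
(`LadyzhenskayaWeightedEstimate.lean`): for a classical solution on `[0, T] × EuclideanSpace ℝ (Fin 3)`, axisymmetric
without swirl at all times, with `curl u(t) = f(t) · J` (`f = ω_θ/r`, the smooth Hadamard quotient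
of `AxisymNoSwirlVorticity.lean`), one has `∫ f(t)² ≤ ∫ f(0)²` provided `|f|`, `‖Df‖`, `|u|` are
bounded on the slab and `∫ f(t)²` is bounded — the weighted enstrophy identity against the weights
`α_ε(r) χ_R / r²` with `ε → 0`, `R → ∞` (the book's (10.25)–(10.26) in the smooth case). This file
supplies those bounds in Tao's class and the two end-point identifications:

* `exists_forall_norm_le_of_sobolev_bounds` — the Sobolev imbedding `W^{2,2}(EuclideanSpace ℝ (Fin 3)) ⊂ C_B` for time
  families with values in any finite-dimensional space
  (`FunctionSpaces.exists_enorm_le_sobolev_two_two_dim_three`), whence in Tao's class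
  (`u ∈ L^∞_t H^k_x` for all `k`) global bounds for `D²u`, `D³u`
  (`IsTaoSolutionOn.exists_bound_fderiv_fderiv(_fderiv)`), for `f` and `Df`
  (`IsTaoSolutionOn.exists_bound_hadamardQuotFst`, `…_fderiv_hadamardQuotFst`: sup bounds of the
  Hadamard quotient, `HadamardQuotient.lean`, through `‖Dⁿ curl u‖ ≤ ‖curlCLM‖ ‖Dⁿ⁺¹u‖`), and the
  integrability of `f(t)²` with `∫ f(t)² ≤ 3‖curlCLM‖² sup_t ‖D²u(t)‖²_{L²}`
  (`IsTaoSolutionOn.integrable_hadamardQuotFst_sq`, from the pointwise Hardy-type bound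
  `f² ≤ |∇ ⊗ ω|²_F`, `sq_le_frobeniusNormSq_fderiv_of_eq_smul_rotGen`, the book's
  `|∇ ⊗ ω|² = |∂ᵣω_θ|² + |∂_zω_θ|² + ω_θ²/r²`, p. 286);
* `IsTaoSolutionOn.integral_hadamardQuotFst_sq_le` — `∫ f(t)² ≤ ∫ f(0)²` in Tao's class;
* `axisymmetricNoSwirl_weightedEnstrophy_le_holds` — off the (null) axis `|ω|² r⁻² = f²`, so the
  weighted enstrophy `∫_{r≠0} |ω(t)|² r⁻²` is `≤ ∫ f(t)² ≤ ∫ f(0)² ≤ ∫ |∇ ⊗ ω₀|²_F`.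

## Mathlib / tree search

Tree: `ladyzhenskaya_weighted_estimate`, `AxisymWeights`, `AxisymVorticityAlgebra`,
`AxisymNoSwirlVorticity` (`curl_eq_hadamardQuotFst_smul_rotGen`), `HadamardQuotient`
(`norm_hadamardQuotFst_le`, `norm_fderiv_hadamardQuotFst_le`), `KNSSThm52Integrand`
(`norm_iteratedFDeriv_curl_le`), `TaoClassGlue` (`IsTaoSolutionOn`, `exists_bound_velocity`),
`TaoLocalisationProofs` (`eLpNorm_two_le_rpow_of_lintegral_sq_le`), `EnstrophyGronwall`
(`frobeniusNormSq_le_three_mul`). `lean search 'norm_le_of_hasBoundedSobolev|exists_bound_fderiv_fderiv'`: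
no sup bound for derivatives of Tao-class solutions in the tree (only for `u` itself,
`linfty_bound_of_hasBoundedSobolevNormsOn_holds`). Mathlib: `norm_iteratedFDeriv_fderiv`,
`iteratedFDeriv_two_apply`, `ContinuousLinearMap.norm_iteratedFDeriv_comp_left`,
`ofReal_integral_eq_lintegral_ofReal`, `setLIntegral_congr_fun`.

## References

* P. G. Lemarié-Rieusset, *The Navier–Stokes Problem in the 21st Century*, CRC Press 2016,
  Thm. 10.4 (held copy p. 285), proof pp. 286–288: (10.25)–(10.27). [LemarieRieusset2016]
* O. A. Ladyzhenskaya, Zap. Naučn. Sem. LOMI 7 (1968), 155–177; M. R. Ukhovskii,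
  V. I. Yudovich, J. Appl. Math. Mech. 32 (1968), 52–69; S. Leonardi, J. Málek, J. Nečas,
  M. Pokorný, Z. Anal. Anwendungen 18 (1999), 639–649.
* R. A. Adams, J. J. F. Fournier, *Sobolev Spaces*, 2nd ed. (2003), Thm. 4.12 Part I Case A.
  [AdamsFournier2003]
-/

noncomputable section

open MeasureTheory Set Function Filter Topology Metric
open scoped RealInnerProductSpace NNReal ENNReal ContDiff

namespace Literature.Analysis.FluidPDE

/-! ### Sup bounds from `L²` Sobolev bounds, for fields with values in any finite-dimensional space -/

/-- **Sobolev imbedding `W^{2,2}(EuclideanSpace ℝ (Fin 3)) → C_B(EuclideanSpace ℝ (Fin 3))` for time families**, values in a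
finite-dimensional normed space: if every slice `g t`, `t ∈ S`, is `C²` and the `L²(EuclideanSpace ℝ (Fin 3))` norms of
`Dʲ(g t)`, `j ≤ 2`, are bounded uniformly in `t ∈ S`, then `‖g t x‖ ≤ B` on `S × EuclideanSpace ℝ (Fin 3)`
(`FunctionSpaces.exists_enorm_le_sobolev_two_two_dim_three`; the vector-valued form of the tree's
`linfty_bound_of_hasBoundedSobolevNormsOn_holds`). [cite: AdamsFournier2003, Thm. 4.12 Part I Case A (mp > n)] -/
theorem exists_forall_norm_le_of_sobolev_bounds {F : Type*} [NormedAddCommGroup F] [NormedSpace ℝ F]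
    [FiniteDimensional ℝ F] {S : Set ℝ} {g : ℝ → EuclideanSpace ℝ (Fin 3) → F} (hg : ∀ t ∈ S, ContDiff ℝ 2 (g t))
    (hH : ∀ j < 3, ∃ C : ℝ≥0, ∀ t ∈ S, ∫⁻ x, ‖iteratedFDeriv ℝ j (g t) x‖ₑ ^ 2 ≤ C) :
    ∃ B : ℝ, 0 ≤ B ∧ ∀ t ∈ S, ∀ x, ‖g t x‖ ≤ B := by
  obtain ⟨K, hK, hbound⟩ := FunctionSpaces.exists_enorm_le_sobolev_two_two_dim_three
    (E := EuclideanSpace ℝ (Fin 3)) (F := F) (volume : Measure (EuclideanSpace ℝ (Fin 3))) finrank_euclideanSpace_fin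
  have hH' : ∀ j : ℕ, ∃ C : ℝ≥0, j < 3 → ∀ t ∈ S, ∫⁻ x, ‖iteratedFDeriv ℝ j (g t) x‖ₑ ^ 2 ≤ C := by
    intro j
    by_cases hj : j < 3
    · obtain ⟨C, hC⟩ := hH j hj
      exact ⟨C, fun _ => hC⟩
    · exact ⟨0, fun h => absurd h hj⟩
  choose C hC using hH'
  set R : ℝ≥0∞ := K * ∑ j ∈ Finset.range 3, ((C j : ℝ≥0∞) ^ (1 / 2 : ℝ)) with hR
  have hRtop : R < ⊤ := by
    refine ENNReal.mul_lt_top hK (ENNReal.sum_lt_top.2 fun j _ => ?_)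
    exact ENNReal.rpow_lt_top_of_nonneg (by norm_num) ENNReal.coe_ne_top
  refine ⟨R.toReal, ENNReal.toReal_nonneg, fun t ht x => ?_⟩
  have h1 : ‖g t x‖ₑ ≤ R := by
    refine (hbound (g t) (hg t ht) x).trans ?_
    rw [hR]
    gcongr with j hj
    exact eLpNorm_two_le_rpow_of_lintegral_sq_le (hC j (Finset.mem_range.1 hj) t ht)
  calc ‖g t x‖ = (‖g t x‖ₑ).toReal := (toReal_enorm (g t x)).symm
    _ ≤ R.toReal := ENNReal.toReal_mono hRtop.ne h1

/-! ### Tao's class: global bounds for `D²u`, `D³u`, for `f = ω_θ/r` and for `Df` -/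

namespace IsTaoSolutionOn

variable {T ν : ℝ} {u₀ : EuclideanSpace ℝ (Fin 3) → EuclideanSpace ℝ (Fin 3)} {u : ℝ → EuclideanSpace ℝ (Fin 3) → EuclideanSpace ℝ (Fin 3)} {p : ℝ → EuclideanSpace ℝ (Fin 3) → ℝ}

/-- In Tao's class the second derivatives `D²u` are bounded on the slab (Sobolev imbedding for
`D(Du)`, whose `L²` Sobolev norms are those of `u` shifted by two). [cite: AdamsFournier2003, Thm. 4.12 Part I Case A (mp > n)] -/
theorem exists_bound_fderiv_fderiv (h : IsTaoSolutionOn T ν u₀ u p) :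
    ∃ B : ℝ, 0 ≤ B ∧ ∀ t ∈ Icc 0 T, ∀ x, ‖fderiv ℝ (fderiv ℝ (u t)) x‖ ≤ B := by
  refine exists_forall_norm_le_of_sobolev_bounds (g := fun t => fderiv ℝ (fderiv ℝ (u t)))
    (fun t ht => ?_) fun j _ => ?_
  · have hu : ContDiff ℝ 4 (u t) := (h.classical.contDiff_velocity ht).of_le (by norm_cast)
    exact (hu.fderiv_right (m := 3) (by norm_num)).fderiv_right (m := 2) (by norm_num)
  obtain ⟨C, hC⟩ := h.sobolev (j + 1 + 1)
  refine ⟨C, fun t ht => le_of_eq_of_le (lintegral_congr fun x => ?_) (hC t ht)⟩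
  rw [← ofReal_norm, norm_iteratedFDeriv_fderiv, norm_iteratedFDeriv_fderiv, ofReal_norm]

set_option maxSynthPendingDepth 2 in
/-- In Tao's class the third derivatives `D³u` are bounded on the slab. [cite: AdamsFournier2003, Thm. 4.12 Part I Case A (mp > n)] -/
theorem exists_bound_fderiv_fderiv_fderiv (h : IsTaoSolutionOn T ν u₀ u p) :
    ∃ B : ℝ, 0 ≤ B ∧ ∀ t ∈ Icc 0 T, ∀ x, ‖fderiv ℝ (fderiv ℝ (fderiv ℝ (u t))) x‖ ≤ B := by
  refine exists_forall_norm_le_of_sobolev_bounds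
    (g := fun t => fderiv ℝ (fderiv ℝ (fderiv ℝ (u t))))
    (fun t ht => ?_) fun j _ => ?_
  · have hu : ContDiff ℝ 5 (u t) := (h.classical.contDiff_velocity ht).of_le (by norm_cast)
    exact ((hu.fderiv_right (m := 4) (by norm_num)).fderiv_right (m := 3) (by norm_num)).fderiv_right
      (m := 2) (by norm_num)
  obtain ⟨C, hC⟩ := h.sobolev (j + 1 + 1 + 1)
  refine ⟨C, fun t ht => le_of_eq_of_le (lintegral_congr fun x => ?_) (hC t ht)⟩
  rw [← ofReal_norm, norm_iteratedFDeriv_fderiv, norm_iteratedFDeriv_fderiv, norm_iteratedFDeriv_fderiv,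
    ofReal_norm]

end IsTaoSolutionOn

/-- The derivative of a component is bounded by the derivative of the field:
`‖D(y ↦ g(y)ᵢ)(x)‖ ≤ ‖Dg(x)‖`. [folklore] -/
theorem norm_fderiv_apply_le {g : EuclideanSpace ℝ (Fin 3) → EuclideanSpace ℝ (Fin 3)} {x : EuclideanSpace ℝ (Fin 3)} (hg : DifferentiableAt ℝ g x) (i : Fin 3) :
    ‖fderiv ℝ (fun y => g y i) x‖ ≤ ‖fderiv ℝ g x‖ := by
  -- `|v i| ≤ ‖v‖` (cf. `abs_apply_le_norm'` of `NSStrongSpeedBound`)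
  have habs : ∀ v : EuclideanSpace ℝ (Fin 3), |v i| ≤ ‖v‖ := fun v => by
    have h : v i ^ 2 ≤ ‖v‖ ^ 2 := by
      rw [EuclideanSpace.norm_sq_eq]
      simp only [Real.norm_eq_abs, sq_abs]
      exact Finset.single_le_sum (f := fun j => v j ^ 2) (fun j _ => sq_nonneg _) (Finset.mem_univ i)
    exact abs_le.2 (abs_le_of_sq_le_sq' h (norm_nonneg _))
  have hd : HasFDerivAt (fun y => g y i)
      ((EuclideanSpace.proj i : EuclideanSpace ℝ (Fin 3) →L[ℝ] ℝ).comp (fderiv ℝ g x)) x :=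
    (EuclideanSpace.proj i : EuclideanSpace ℝ (Fin 3) →L[ℝ] ℝ).hasFDerivAt.comp x hg.hasFDerivAt
  rw [hd.fderiv]
  refine ContinuousLinearMap.opNorm_le_bound _ (norm_nonneg _) fun h => ?_
  calc ‖((EuclideanSpace.proj i : EuclideanSpace ℝ (Fin 3) →L[ℝ] ℝ).comp (fderiv ℝ g x)) h‖ = |fderiv ℝ g x h i| := rfl
    _ ≤ ‖fderiv ℝ g x h‖ := habs _
    _ ≤ ‖fderiv ℝ g x‖ * ‖h‖ := ContinuousLinearMap.le_opNorm _ _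

/-- Second derivatives of a component against the iterated derivative of the field:
`‖D(y ↦ D(g·ᵢ)(y) e)(x)‖ ≤ ‖D²g(x)‖ ‖e‖` for `g ∈ C²`. [folklore] -/
theorem norm_fderiv_fderiv_apply_apply_le {g : EuclideanSpace ℝ (Fin 3) → EuclideanSpace ℝ (Fin 3)} (hg : ContDiff ℝ 2 g) (i : Fin 3) (e x : EuclideanSpace ℝ (Fin 3)) :
    ‖fderiv ℝ (fun y => fderiv ℝ (fun z => g z i) y e) x‖ ≤ ‖iteratedFDeriv ℝ 2 g x‖ * ‖e‖ := by
  have habs : ∀ v : EuclideanSpace ℝ (Fin 3), |v i| ≤ ‖v‖ := fun v => by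
    have h : v i ^ 2 ≤ ‖v‖ ^ 2 := by
      rw [EuclideanSpace.norm_sq_eq]
      simp only [Real.norm_eq_abs, sq_abs]
      exact Finset.single_le_sum (f := fun j => v j ^ 2) (fun j _ => sq_nonneg _) (Finset.mem_univ i)
    exact abs_le.2 (abs_le_of_sq_le_sq' h (norm_nonneg _))
  set gi : EuclideanSpace ℝ (Fin 3) → ℝ := fun z => g z i with hgi
  have hgi2 : ContDiff ℝ 2 gi := (EuclideanSpace.proj i : EuclideanSpace ℝ (Fin 3) →L[ℝ] ℝ).contDiff.comp hg
  have hD : DifferentiableAt ℝ (fderiv ℝ gi) x :=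
    ((hgi2.fderiv_right (m := 1) (by norm_num)).differentiable one_ne_zero) x
  have heq : fderiv ℝ (fun y => fderiv ℝ gi y e) x = (fderiv ℝ (fderiv ℝ gi) x).flip e := by
    rw [fderiv_clm_apply hD (differentiableAt_const _)]
    simp [fderiv_fun_const]
  -- `‖D²gᵢ‖ ≤ ‖D²g‖`
  have hcomp : ‖iteratedFDeriv ℝ 2 gi x‖ ≤ ‖iteratedFDeriv ℝ 2 g x‖ := by
    have h1 := ContinuousLinearMap.norm_iteratedFDeriv_comp_left
      (EuclideanSpace.proj i : EuclideanSpace ℝ (Fin 3) →L[ℝ] ℝ) (f := g) (x := x) (n := 2) hg.contDiffAt le_rfl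
    have hnorm : ‖(EuclideanSpace.proj i : EuclideanSpace ℝ (Fin 3) →L[ℝ] ℝ)‖ ≤ 1 :=
      ContinuousLinearMap.opNorm_le_bound _ zero_le_one fun v => by
        rw [one_mul]; exact habs v
    calc ‖iteratedFDeriv ℝ 2 gi x‖ = ‖iteratedFDeriv ℝ 2 ((EuclideanSpace.proj i : EuclideanSpace ℝ (Fin 3) →L[ℝ] ℝ) ∘ g) x‖ := rfl
      _ ≤ ‖(EuclideanSpace.proj i : EuclideanSpace ℝ (Fin 3) →L[ℝ] ℝ)‖ * ‖iteratedFDeriv ℝ 2 g x‖ := h1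
      _ ≤ 1 * ‖iteratedFDeriv ℝ 2 g x‖ := by gcongr
      _ = ‖iteratedFDeriv ℝ 2 g x‖ := one_mul _
  rw [heq]
  refine ContinuousLinearMap.opNorm_le_bound _ (by positivity) fun h => ?_
  rw [ContinuousLinearMap.flip_apply]
  have h2 := (iteratedFDeriv ℝ 2 gi x).le_opNorm ![h, e]
  rw [iteratedFDeriv_two_apply] at h2
  simp only [Fin.prod_univ_two, Matrix.cons_val_zero, Matrix.cons_val_one] at h2
  calc ‖fderiv ℝ (fderiv ℝ gi) x h e‖ ≤ ‖iteratedFDeriv ℝ 2 gi x‖ * (‖h‖ * ‖e‖) := h2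
    _ ≤ ‖iteratedFDeriv ℝ 2 g x‖ * (‖h‖ * ‖e‖) := by gcongr
    _ = ‖iteratedFDeriv ℝ 2 g x‖ * ‖e‖ * ‖h‖ := by ring

namespace IsTaoSolutionOn

variable {T ν : ℝ} {u₀ : EuclideanSpace ℝ (Fin 3) → EuclideanSpace ℝ (Fin 3)} {u : ℝ → EuclideanSpace ℝ (Fin 3) → EuclideanSpace ℝ (Fin 3)} {p : ℝ → EuclideanSpace ℝ (Fin 3) → ℝ}

/-- **`f = ω_θ/r` is bounded on the slab in Tao's class**: `|hadamardQuotFst (curl u(t))₁| ≤ F`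
(sup bound of the Hadamard quotient by `‖D(curl u)₁‖ ≤ ‖D curl u‖ ≤ ‖curlCLM‖ ‖D²u‖`).
[folklore] -/
theorem exists_bound_hadamardQuotFst (h : IsTaoSolutionOn T ν u₀ u p) :
    ∃ F : ℝ, ∀ t ∈ Icc 0 T, ∀ x, |hadamardQuotFst (fun y => curl (u t) y 1) x| ≤ F := by
  obtain ⟨B, -, hB⟩ := h.exists_bound_fderiv_fderiv
  refine ⟨‖curlCLM‖ * B, fun t ht x => ?_⟩
  have hu2 : ContDiff ℝ 2 (u t) := (h.classical.contDiff_velocity ht).of_le (by norm_cast)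
  have hω1 : ContDiff ℝ 1 (curl (u t)) := contDiff_curl (n := 1) (by exact_mod_cast hu2)
  have hb : ∀ y, ‖fderiv ℝ (fun y => curl (u t) y 1) y‖ ≤ ‖curlCLM‖ * B := fun y => by
    refine (norm_fderiv_apply_le ((hω1.differentiable one_ne_zero) y) 1).trans ?_
    refine (norm_fderiv_curl_le hu2 y).trans ?_
    rw [← norm_iteratedFDeriv_fderiv, norm_iteratedFDeriv_one]
    exact mul_le_mul_of_nonneg_left (hB t ht y) (norm_nonneg curlCLM)
  have := norm_hadamardQuotFst_le hb x
  rwa [Real.norm_eq_abs] at this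

/-- **`Df` is bounded on the slab in Tao's class**: `‖D(hadamardQuotFst (curl u(t))₁)‖ ≤ G`
(sup bound of the derivative of the Hadamard quotient by
`‖D ∂₀(curl u)₁‖ ≤ ‖D²(curl u)‖ ≤ ‖curlCLM‖ ‖D³u‖`). [folklore] -/
theorem exists_bound_fderiv_hadamardQuotFst (h : IsTaoSolutionOn T ν u₀ u p) :
    ∃ G : ℝ, ∀ t ∈ Icc 0 T, ∀ x,
      ‖fderiv ℝ (hadamardQuotFst (fun y => curl (u t) y 1)) x‖ ≤ G := by
  obtain ⟨B, -, hB⟩ := h.exists_bound_fderiv_fderiv_fderiv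
  refine ⟨‖curlCLM‖ * B, fun t ht x => ?_⟩
  have hu3 : ContDiff ℝ 3 (u t) := (h.classical.contDiff_velocity ht).of_le (by norm_cast)
  have hω2 : ContDiff ℝ 2 (curl (u t)) := contDiff_curl (n := 2) (by exact_mod_cast hu3)
  have hω12 : ContDiff ℝ 2 (fun y => curl (u t) y 1) :=
    (EuclideanSpace.proj (1 : Fin 3) : EuclideanSpace ℝ (Fin 3) →L[ℝ] ℝ).contDiff.comp hω2
  refine norm_fderiv_hadamardQuotFst_le hω12 (fun y => ?_) x
  refine (norm_fderiv_fderiv_apply_apply_le hω2 1 (EuclideanSpace.single (0 : Fin 3) (1 : ℝ)) y).trans ?_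
  rw [PiLp.norm_single, norm_one, mul_one]
  refine (norm_iteratedFDeriv_curl_le (n := 2) (by exact_mod_cast hu3) y).trans ?_
  refine mul_le_mul_of_nonneg_left ?_ (norm_nonneg curlCLM)
  rw [← norm_iteratedFDeriv_fderiv, ← norm_iteratedFDeriv_fderiv, norm_iteratedFDeriv_one]
  exact hB t ht y


/-- **`f(t)² ≤ |D curl u(t)|²_F ≤ 3‖curlCLM‖² ‖D²u(t)‖²` is integrable with a uniform bound** in
Tao's class (Hardy-type pointwise bound `sq_le_frobeniusNormSq_fderiv_of_eq_smul_rotGen` and the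
`L²` bound on `D²u`). [cite: LemarieRieusset2016, §10.3 p. 286] -/
theorem integrable_hadamardQuotFst_sq (h : IsTaoSolutionOn T ν u₀ u p)
    (hax : ∀ t ∈ Icc 0 T, IsAxisymmetric (u t)) (hsw : ∀ t ∈ Icc 0 T, HasNoSwirl (u t)) :
    ∃ Fstar : ℝ, ∀ t ∈ Icc 0 T,
      Integrable (fun x => hadamardQuotFst (fun y => curl (u t) y 1) x ^ 2) ∧
      (∫ x, hadamardQuotFst (fun y => curl (u t) y 1) x ^ 2 ≤ Fstar) ∧
      ∀ x, hadamardQuotFst (fun y => curl (u t) y 1) x ^ 2 ≤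
        frobeniusNormSq (fderiv ℝ (curl (u t)) x) := by
  obtain ⟨C, hC⟩ := h.sobolev 2
  refine ⟨(3 * ‖curlCLM‖ ^ 2 * C : ℝ), fun t ht => ?_⟩
  have hu3 : ContDiff ℝ 3 (u t) := (h.classical.contDiff_velocity ht).of_le (by norm_cast)
  have hu2 : ContDiff ℝ 2 (u t) := hu3.of_le (by norm_num)
  set f := hadamardQuotFst (fun y => curl (u t) y 1) with hf
  have hfC1 : ContDiff ℝ 1 f := contDiff_hadamardQuotFst_curl (n := 1) (by exact_mod_cast hu3)
  have hωf : curl (u t) = fun y => f y • rotGen y :=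
    funext fun y => curl_eq_hadamardQuotFst_smul_rotGen (hax t ht) (hsw t ht) hu2 y
  have hpt : ∀ x, f x ^ 2 ≤ frobeniusNormSq (fderiv ℝ (curl (u t)) x) := fun x =>
    sq_le_frobeniusNormSq_fderiv_of_eq_smul_rotGen hωf ((hfC1.differentiable one_ne_zero) x)
  have hpt' : ∀ x, f x ^ 2 ≤ 3 * ‖curlCLM‖ ^ 2 * ‖iteratedFDeriv ℝ 2 (u t) x‖ ^ 2 := fun x => by
    refine (hpt x).trans ((frobeniusNormSq_le_three_mul _).trans ?_)
    have h1 := norm_fderiv_curl_le hu2 x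
    have h0 : 0 ≤ ‖fderiv ℝ (curl (u t)) x‖ := norm_nonneg _
    calc 3 * ‖fderiv ℝ (curl (u t)) x‖ ^ 2 ≤ 3 * (‖curlCLM‖ * ‖iteratedFDeriv ℝ 2 (u t) x‖) ^ 2 := by
          gcongr
      _ = 3 * ‖curlCLM‖ ^ 2 * ‖iteratedFDeriv ℝ 2 (u t) x‖ ^ 2 := by ring
  -- the lintegral bound
  have hlin : ∫⁻ x, ENNReal.ofReal (f x ^ 2) ≤ ENNReal.ofReal (3 * ‖curlCLM‖ ^ 2) * C := by
    calc ∫⁻ x, ENNReal.ofReal (f x ^ 2)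
        ≤ ∫⁻ x, ENNReal.ofReal (3 * ‖curlCLM‖ ^ 2) * ‖iteratedFDeriv ℝ 2 (u t) x‖ₑ ^ 2 :=
          lintegral_mono fun x => by
            refine (ENNReal.ofReal_le_ofReal (hpt' x)).trans_eq ?_
            rw [ENNReal.ofReal_mul (by positivity), ENNReal.ofReal_pow (norm_nonneg _), ofReal_norm]
      _ = ENNReal.ofReal (3 * ‖curlCLM‖ ^ 2) * ∫⁻ x, ‖iteratedFDeriv ℝ 2 (u t) x‖ₑ ^ 2 :=
          lintegral_const_mul' _ _ ENNReal.ofReal_ne_top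
      _ ≤ ENNReal.ofReal (3 * ‖curlCLM‖ ^ 2) * C := by gcongr; exact hC t ht
  have hfin : ∫⁻ x, ENNReal.ofReal (f x ^ 2) < ⊤ :=
    hlin.trans_lt (ENNReal.mul_lt_top ENNReal.ofReal_lt_top ENNReal.coe_lt_top)
  have hmeas : AEStronglyMeasurable (fun x => f x ^ 2) volume :=
    (hfC1.continuous.pow 2).aestronglyMeasurable
  have hint : Integrable (fun x => f x ^ 2) := by
    refine ⟨hmeas, ?_⟩
    rw [hasFiniteIntegral_iff_enorm]
    refine lt_of_le_of_lt (lintegral_congr fun x => ?_).le hfin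
    rw [Real.enorm_eq_ofReal (sq_nonneg _)]
  refine ⟨hint, ?_, hpt⟩
  -- the real bound
  rw [integral_eq_lintegral_of_nonneg_ae (ae_of_all _ fun x => sq_nonneg _) hmeas]
  have hne : ENNReal.ofReal (3 * ‖curlCLM‖ ^ 2) * (C : ℝ≥0∞) ≠ ⊤ :=
    ENNReal.mul_ne_top ENNReal.ofReal_ne_top ENNReal.coe_ne_top
  refine (ENNReal.toReal_mono hne hlin).trans_eq ?_
  rw [ENNReal.toReal_mul, ENNReal.toReal_ofReal (by positivity), ENNReal.coe_toReal]

/-- **Ladyzhenskaya's estimate in Tao's class**: for a Tao-class solution on `[0, T] × EuclideanSpace ℝ (Fin 3)` which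
is axisymmetric without swirl at all times, `∫ f(t)² ≤ ∫ f(0)²` for `t ∈ [0, T]`, `f = ω_θ/r`
(`ladyzhenskaya_weighted_estimate` with the global bounds of the class). [cite: LemarieRieusset2016, §10.3 Thm. 10.4 proof, (10.27) p. 288] -/
theorem integral_hadamardQuotFst_sq_le (h : IsTaoSolutionOn T ν u₀ u p) (hT : 0 < T) (hν : 0 ≤ ν)
    (hax : ∀ t ∈ Icc 0 T, IsAxisymmetric (u t)) (hsw : ∀ t ∈ Icc 0 T, HasNoSwirl (u t))
    {t : ℝ} (ht : t ∈ Icc 0 T) :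
    ∫ x, hadamardQuotFst (fun y => curl (u t) y 1) x ^ 2 ≤
      ∫ x, hadamardQuotFst (fun y => curl (u 0) y 1) x ^ 2 := by
  obtain ⟨F, hF⟩ := h.exists_bound_hadamardQuotFst
  obtain ⟨G, hG⟩ := h.exists_bound_fderiv_hadamardQuotFst
  obtain ⟨V, -, hV⟩ := h.exists_bound_velocity
  obtain ⟨Fstar, hFs⟩ := h.integrable_hadamardQuotFst_sq hax hsw
  exact ladyzhenskaya_weighted_estimate hT hν h.classical hax hsw hF hG hV (fun s hs => (hFs s hs).1)
    (fun s hs => (hFs s hs).2.1) t ht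

end IsTaoSolutionOn

/-! ### The named fact -/

/-- The complement of the axis `{r ≠ 0}` is measurable (it is open). [folklore] -/
theorem measurableSet_cylRadius_ne_zero : MeasurableSet {x : EuclideanSpace ℝ (Fin 3) | cylRadius x ≠ 0} :=
  (isOpen_ne_fun continuous_cylRadius continuous_const).measurableSet

/-- **Discharge of `axisymmetricNoSwirl_weightedEnstrophy_le`** (Lemarié-Rieusset 2016, proof of
Thm. 10.4, (10.27) with `f = 0`, p. 288): for a Tao-class solution on `[0, T] × EuclideanSpace ℝ (Fin 3)` which is
axisymmetric without swirl at all times and `t ∈ [0, T]`,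
`∫_{r ≠ 0} |curl u(t)|² r⁻² dx ≤ ∫ |∇ ⊗ curl u₀|² dx`. Proof: off the axis
`|ω|² r⁻² = f²` with `ω = f · J` (`curl_eq_hadamardQuotFst_smul_rotGen`); Ladyzhenskaya's
estimate `∫ f(t)² ≤ ∫ f(0)²` (`IsTaoSolutionOn.integral_hadamardQuotFst_sq_le`, from the tree's
`ladyzhenskaya_weighted_estimate` and the global bounds of Tao's class); and the pointwise
Hardy-type bound `f(0)² ≤ |∇ ⊗ ω₀|²_F` (`sq_le_frobeniusNormSq_fderiv_of_eq_smul_rotGen`,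
the book's `|∇ ⊗ ω|² = |∂ᵣω_θ|² + |∂_zω_θ|² + ω_θ²/r²`, p. 286). [cite: LemarieRieusset2016, Thm. 10.4, proof: (10.27), p. 288 (with (10.25)–(10.26), pp. 286–287)] -/
theorem axisymmetricNoSwirl_weightedEnstrophy_le_holds : axisymmetricNoSwirl_weightedEnstrophy_le := by
  intro ν T hν hT u₀ u p h hax hsw t ht
  have h0 : (0 : ℝ) ∈ Icc 0 T := ⟨le_rfl, hT.le⟩
  obtain ⟨Fstar, hFs⟩ := h.integrable_hadamardQuotFst_sq hax hsw
  obtain ⟨hint_t, -, -⟩ := hFs t ht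
  obtain ⟨hint_0, -, hhardy⟩ := hFs 0 h0
  set ft : EuclideanSpace ℝ (Fin 3) → ℝ := hadamardQuotFst (fun y => curl (u t) y 1) with hft
  set f0 : EuclideanSpace ℝ (Fin 3) → ℝ := hadamardQuotFst (fun y => curl (u 0) y 1) with hf0
  have hu2 : ContDiff ℝ 2 (u t) := (h.classical.contDiff_velocity ht).of_le (by norm_cast)
  have hωf : curl (u t) = fun y => ft y • rotGen y :=
    funext fun y => curl_eq_hadamardQuotFst_smul_rotGen (hax t ht) (hsw t ht) hu2 y
  -- off the axis `|ω|² r⁻² = f²`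
  have heq : EqOn (fun x => ENNReal.ofReal (‖curl (u t) x‖ ^ 2 / cylRadius x ^ 2))
      (fun x => ENNReal.ofReal (ft x ^ 2)) {x : EuclideanSpace ℝ (Fin 3) | cylRadius x ≠ 0} := by
    intro x hx
    have hx' : cylRadius x ≠ 0 := hx
    simp only
    rw [norm_sq_of_eq_smul_rotGen hωf x, ← cylRadius_sq, mul_div_assoc, div_self (pow_ne_zero 2 hx'),
      mul_one]
  calc ∫⁻ x in {x : EuclideanSpace ℝ (Fin 3) | cylRadius x ≠ 0}, ENNReal.ofReal (‖curl (u t) x‖ ^ 2 / cylRadius x ^ 2)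
      = ∫⁻ x in {x : EuclideanSpace ℝ (Fin 3) | cylRadius x ≠ 0}, ENNReal.ofReal (ft x ^ 2) :=
        setLIntegral_congr_fun measurableSet_cylRadius_ne_zero heq
    _ ≤ ∫⁻ x, ENNReal.ofReal (ft x ^ 2) := setLIntegral_le_lintegral _ _
    _ = ENNReal.ofReal (∫ x, ft x ^ 2) :=
        (ofReal_integral_eq_lintegral_ofReal hint_t (ae_of_all _ fun x => sq_nonneg _)).symm
    _ ≤ ENNReal.ofReal (∫ x, f0 x ^ 2) :=
        ENNReal.ofReal_le_ofReal (h.integral_hadamardQuotFst_sq_le hT hν.le hax hsw ht)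
    _ = ∫⁻ x, ENNReal.ofReal (f0 x ^ 2) :=
        ofReal_integral_eq_lintegral_ofReal hint_0 (ae_of_all _ fun x => sq_nonneg _)
    _ ≤ ∫⁻ x, ENNReal.ofReal (frobeniusNormSq (fderiv ℝ (curl u₀) x)) := by
        refine lintegral_mono fun x => ENNReal.ofReal_le_ofReal ?_
        rw [← h.initial]
        exact hhardy x

end Literature.Analysis.FluidPDE

end
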